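import Summits.CriticalPhenomena.PercolationContinuityZ3.Theorems.PercNearOneGluingNoHeavyPcintBFibExplore
import Literature.Probability.Percolation.HarrisLocal
import Literature.Probability.Percolation.RussoFormula
import Literature.Probability.Percolation.SharpnessDCTProofs
import Literature.Probability.Percolation.SharpnessQuasiTransitive
import Literature.Probability.LatticeModels.TriangularLatticeProofs
import HarnessLib

/-!
# PCINT lane, T-fibre route PHASE 3 (bond), step (5a): the `𝕋`-side bridge — the arm event as an exploration payoff

Cell `prim-pcint`, seat `prim-pcint-1` (gen 13); memo `run/shared/lean/prim/pcint/T-FIBRE-ROUTE.md` (PHASE 3).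

Bridge between the tree's bond percolation measure and the finite sums of `AdaptDom`, for an arbitrary locally finite
graph `G` (used with the triangular lattice): for the ball `Λ = B(v, n)` of the graph metric,

  `P_s(v ⟷ ∂B(v, n) in B(v, n)) ≤ Σ_{a : EΛ → Bool} π_s(a) · reachInd G o B a`,

where `EΛ` are the edges of `G` inside `Λ`, `o = v`, and `B` is the set of sites of `Λ` on its inner boundary
(`EdgeExpl.real_armEvent_le_sum_wt_reach`).  Ingredients: the cylinder weights of `P_s` on edge coordinates are the product
Bernoulli weights (`cylWeight_eq_wt`, via `Russo.setBernoulli_real_localCylinder`), the finite-dimensional distributions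
`real_eq_sum_of_determinedBy`, and `P_s`-a.s. `ω ⊆ E(G)` (`DCT16.real_mono_of_forall_subset_edgeSet`).
-/

noncomputable section

namespace Summit.CriticalPhenomena.PercolationContinuityZ3.Theorems.Pcint

namespace EdgeExpl

open Finset MeasureTheory AdaptDom Literature.Probability.Percolation Literature.Probability.LatticeModels
open scoped ProbabilityTheory

variable {W : Type*} [DecidableEq W] {G : SimpleGraph W} [DecidableRel G.Adj]

/-! ### Cylinder weights on edge coordinates are product Bernoulli weights -/

omit [DecidableEq W] [DecidableRel G.Adj] in
/-- The cylinder of a pattern is the local cylinder of its configuration. -/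
theorem cylOf_eq_localCylinder (F : Finset (Sym2 W)) (a : ↥F → Bool) :
    cylOf F a = localCylinder (↑F : Set (Sym2 W)) (cfgOf F a) := by
  ext ω
  simp only [cylOf, localCylinder, cfgOf, Set.mem_setOf_eq, Finset.mem_coe]
  constructor
  · intro h e he
    rw [h e he]
    exact ⟨fun ha => ⟨he, ha⟩, fun ⟨_, ha⟩ => ha⟩
  · intro h e he
    rw [h e he]
    exact ⟨fun ⟨_, ha⟩ => ha, fun ha => ⟨he, ha⟩⟩

omit [DecidableEq W] [DecidableRel G.Adj] in
/-- **On edge coordinates the cylinder weights of `P_p` are the product Bernoulli weights `π_p`.** -/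
theorem cylWeight_eq_wt (p : unitInterval) (F : Finset (Sym2 W)) (hF : ∀ e ∈ F, e ∈ G.edgeSet) (a : ↥F → Bool) :
    cylWeight G p F a = wt (p : ℝ) a := by
  classical
  rw [← real_cylOf, cylOf_eq_localCylinder, bondPercolation, Russo.setBernoulli_real_localCylinder]
  unfold wt
  rw [← Finset.prod_attach]
  refine Finset.prod_congr rfl fun e _ => ?_
  have hmem : (e.1 ∈ cfgOf F a) ↔ a e = true := by
    simp only [cfgOf, Set.mem_setOf_eq]
    exact ⟨fun ⟨_, h⟩ => h, fun h => ⟨e.2, h⟩⟩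
  unfold Russo.weight bern
  rw [if_pos (hF e.1 e.2), if_pos (hF e.1 e.2)]
  by_cases h : a e = true
  · rw [if_pos (hmem.2 h), if_pos h]
  · rw [if_neg (fun h' => h (hmem.1 h')), if_neg h]

/-! ### The arm event as an exploration payoff -/

variable [G.LocallyFinite] (v : W) (n : ℕ)

variable (G) in
open Classical in
/-- The pattern of a bond configuration on the items of the ball `Λ = B(v, n)`. -/
def patOf (ω : BondConfig W) : ↥(EΛ G (DCTQ.ball G v n)) → Bool := fun e => decide ((e : Sym2 W) ∈ ω)

variable (G) in
/-- The event that the open items of `EΛ` (for `Λ = B(v, n)`) join the root to the inner boundary of the ball: a version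
of the arm event that reads only the edge coordinates inside the ball. -/
def reachEvent : Set (BondConfig W) :=
  {ω | ∃ b ∈ (DCTQ.ball G v n).attach.filter (fun b => b.1 ∈ innerBoundary G (DCTQ.ball G v n)),
    ReachE ⟨v, DCTQ.mem_ball_self v n⟩ (patOf G v n ω) b}

variable {v n}

open Classical in
/-- `patOf ω e = true ↔ e ∈ ω`. -/
theorem patOf_eq_true_iff {ω : BondConfig W} {e : ↥(EΛ G (DCTQ.ball G v n))} :
    patOf G v n ω e = true ↔ (e : Sym2 W) ∈ ω := by
  simp only [patOf, decide_eq_true_eq]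

/-- Configurations agreeing on `EΛ` have the same pattern. -/
theorem patOf_congr {ω ω' : BondConfig W}
    (h : ω ∩ ↑(EΛ G (DCTQ.ball G v n)) = ω' ∩ ↑(EΛ G (DCTQ.ball G v n))) : patOf G v n ω = patOf G v n ω' := by
  funext e
  have h1 : (e : Sym2 W) ∈ ω ↔ (e : Sym2 W) ∈ ω' := by
    constructor
    · intro he; exact ((Set.ext_iff.1 h e.1).1 ⟨he, e.2⟩).1
    · intro he; exact ((Set.ext_iff.1 h e.1).2 ⟨he, e.2⟩).1
  rw [Bool.eq_iff_iff, patOf_eq_true_iff, patOf_eq_true_iff, h1]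

/-- The pattern of a configuration inside the ball is determined by the coordinates of `EΛ`. -/
theorem determinedBy_reachEvent : DeterminedBy (reachEvent G v n) (↑(EΛ G (DCTQ.ball G v n)) : Set (Sym2 W)) := by
  rw [determinedBy_iff]
  intro ω ω' h
  unfold reachEvent
  simp only [Set.mem_setOf_eq, patOf_congr h]

/-- **An arm inside the ball gives an open path of items** (for configurations supported on the edges of `G`). -/
theorem mem_reachEvent_of_mem_armEvent {ω : BondConfig W} (hω : ω ⊆ G.edgeSet) (h : ω ∈ DCTQ.armEvent G v n) :
    ω ∈ reachEvent G v n := by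
  obtain ⟨b, hb, hpath⟩ := DCTQ.mem_armEvent_iff.1 h
  have hbΛ : b ∈ DCTQ.ball G v n := (mem_innerBoundary_iff.1 hb).1
  refine ⟨⟨b, hbΛ⟩, mem_filter.2 ⟨mem_attach _ _, hb⟩, ?_⟩
  -- transport the open path inside the ball to the items
  have key : ∀ {t : W}, Relation.ReflTransGen (fun a c => (openGraph ω).Adj a c ∧ c ∈ (↑(DCTQ.ball G v n) : Set W)) v t →
      ∃ ht : t ∈ DCTQ.ball G v n, ReachE ⟨v, DCTQ.mem_ball_self v n⟩ (patOf G v n ω) ⟨t, ht⟩ := by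
    intro t h
    induction h with
    | refl => exact ⟨DCTQ.mem_ball_self v n, Relation.ReflTransGen.refl⟩
    | @tail u t _ hut ih =>
      obtain ⟨hu, hchain⟩ := ih
      obtain ⟨⟨hmem, hne⟩, htΛ⟩ := And.intro ((openGraph_adj ω u t).1 hut.1) hut.2
      have htΛ' : t ∈ DCTQ.ball G v n := htΛ
      have hadj : G.Adj u t := by
        have := hω hmem; rwa [SimpleGraph.mem_edgeSet] at this
      have he : s(u, t) ∈ EΛ G (DCTQ.ball G v n) :=
        mk_mem_EΛ (a := ⟨u, hu⟩) (b := ⟨t, htΛ'⟩) hadj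
      exact ⟨htΛ', hchain.tail ⟨⟨s(u, t), he⟩, patOf_eq_true_iff.2 hmem, rfl⟩⟩
  exact (key hpath.2).2

/-- **The `𝕋`-side bridge**: `P_s(v ⟷ ∂B(v,n) in B(v,n)) ≤ E_{π_s}[reachInd]`. -/
theorem real_armEvent_le_sum_wt_reach [Countable W] (q : unitInterval) :
    (bondPercolation G q).real (DCTQ.armEvent G v n) ≤
      ∑ a : ↥(EΛ G (DCTQ.ball G v n)) → Bool, wt (q : ℝ) a *
        reachInd G ⟨v, DCTQ.mem_ball_self v n⟩
          ((DCTQ.ball G v n).attach.filter fun b => b.1 ∈ innerBoundary G (DCTQ.ball G v n)) a := by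
  classical
  have h1 : (bondPercolation G q).real (DCTQ.armEvent G v n) ≤ (bondPercolation G q).real (reachEvent G v n) :=
    DCT16.real_mono_of_forall_subset_edgeSet G q fun ω hω h => mem_reachEvent_of_mem_armEvent hω h
  refine h1.trans (le_of_eq ?_)
  rw [real_eq_sum_of_determinedBy G q (EΛ G (DCTQ.ball G v n)) determinedBy_reachEvent]
  have hF : ∀ e ∈ EΛ G (DCTQ.ball G v n), e ∈ G.edgeSet := fun e he => (mem_EΛ_iff.1 he).2
  -- termwise identification (the two sums carry different `Fintype` instances: finish with `convert`)
  have key : ∀ a : ↥(EΛ G (DCTQ.ball G v n)) → Bool,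
      cylWeight G q (EΛ G (DCTQ.ball G v n)) a * (reachEvent G v n).indicator 1 (cfgOf (EΛ G (DCTQ.ball G v n)) a) =
        wt (q : ℝ) a * reachInd G ⟨v, DCTQ.mem_ball_self v n⟩
          ((DCTQ.ball G v n).attach.filter fun b => b.1 ∈ innerBoundary G (DCTQ.ball G v n)) a := by
    intro a
    rw [cylWeight_eq_wt q _ hF a]
    refine congrArg (fun t : ℝ => wt (q : ℝ) a * t) ?_
    have hpat : patOf G v n (cfgOf (EΛ G (DCTQ.ball G v n)) a) = a := by
      funext e
      have : ((e : Sym2 W) ∈ cfgOf (EΛ G (DCTQ.ball G v n)) a) ↔ a e = true := by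
        simp only [cfgOf, Set.mem_setOf_eq]; exact ⟨fun ⟨_, h⟩ => h, fun h => ⟨e.2, h⟩⟩
      rw [Bool.eq_iff_iff, patOf_eq_true_iff, this]
    unfold reachInd
    by_cases hr : ∃ b ∈ (DCTQ.ball G v n).attach.filter (fun b => b.1 ∈ innerBoundary G (DCTQ.ball G v n)),
        ReachE ⟨v, DCTQ.mem_ball_self v n⟩ a b
    · rw [if_pos hr, Set.indicator_of_mem]
      · rfl
      · show cfgOf (EΛ G (DCTQ.ball G v n)) a ∈ reachEvent G v n
        unfold reachEvent; rw [Set.mem_setOf_eq, hpat]; exact hr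
    · rw [if_neg hr, Set.indicator_of_notMem]
      intro hmem
      apply hr
      unfold reachEvent at hmem; rw [Set.mem_setOf_eq, hpat] at hmem; exact hmem
  rw [Finset.sum_congr rfl fun a _ => key a]
  convert rfl

end EdgeExpl

end Summit.CriticalPhenomena.PercolationContinuityZ3.Theorems.Pcint

end
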